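import Mathlib
import HarnessLib
import Summits.Ventures.LatticeQCDFlow.Exactness.LazyRelaxationLagLaw

/-!
# Granularity versus relaxation at a fixed sweep budget: the equal-drop hypothesis is needed (a 2-state witness)

HONEST FRAMING: exact (Metropolis-corrected) sampling algorithms for lattice gauge theory;
figures of merit are autocorrelation/cost numbers at stated couplings and volumes; no
continuum-physics claim.

Venture `LatticeQCDFlow` (cell pub-lqcd), topic `Exactness`, FANOUT row 8 (s0-cpn-nemc, GEN-5).
OUR WORK (an explicit finite computation), nothing cited as a fact.  Companion of
`Exactness/LazyRelaxationGranularity.lean` (`lazyDissipation_halving_le`: with EQUAL equilibrium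
drops of the switch observable along the fine grid, `2n` switches with one lazy sweep each
dissipate no more than `n` switches with two sweeps each).  Without the equal-drop hypothesis the
comparison can go the other way:

* `lazyDissipation_halving_witness` — two states, `S₀ = (0, 15 log 2)`, `D = (0, −40 log 2)`
  (so `⟨D⟩_c = −40 log 2 · w/(1 + w)`, `w = 2^{40c − 15}`: the switch observable drops from
  `≈ 0` to `≈ −40 log 2` in ONE step between `c = 1/4` and `c = 1/2`), `n = 2`, `ε = 1/2`:
  `⟨W⟩ − ΔF [2 steps, laziness 1/4] < ⟨W⟩ − ΔF [4 steps, laziness 1/2]` (numerically `−ΔF − 10.08`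
  versus `−ΔF − 8.69`): the fine protocol spends a sweep at `c = 1/4`, where nothing has dropped
  yet, while the coarse one spends both sweeps after the drop;
* `not_lazyDissipation_halving_le` — hence the conclusion of `lazyDissipation_halving_le` fails for
  SOME finite system, grid size and laziness: the equal-drop hypothesis cannot be removed.

Reading (HOME/s0-cpn-nemc/RESULTS.md §12(d)): the design lever "buy granularity, not relaxation"
(HOME/ADJ-S0-D2-flow.md L2) is exact for the quasi-static floor (`qsDissipation_uniform_two_mul_le`)
and for the lag when the drops are spread evenly; with a sharply localised drop, relaxation is
worth most right AFTER the drop (`e_{j+1} = ε_j (e_j + δ_j)`).  BNV's defect protocol has a smooth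
`⟨D⟩_c` (`Var_c(D)` varies ×7.4 over `c`, no step; RESULTS §9), the regime of the positive theorem.
-/

namespace Summit.Ventures.LatticeQCDFlow.Exactness

open Finset
open Summit.Ventures.LatticeQCDFlow.Theory2

namespace HalvingWitness

/-- `exp(k · log 2) = 2^k`. -/
theorem exp_nat_mul_log_two (k : ℕ) : Real.exp ((k : ℝ) * Real.log 2) = (2 : ℝ) ^ k := by
  rw [← Real.log_pow, Real.exp_log (by positivity)]

/-- The switch observable's equilibrium mean for the two-state witness, in closed form:
`⟨D⟩_c = −40 log 2 · w / (1 + w)` with `w = exp((40c − 15) log 2)`. -/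
theorem meanD_eq (c : ℝ) :
    meanD ![(0 : ℝ), 15 * Real.log 2] ![(0 : ℝ), -(40 * Real.log 2)] c
      = -(40 * Real.log 2) * (Real.exp ((40 * c - 15) * Real.log 2)
          / (1 + Real.exp ((40 * c - 15) * Real.log 2))) := by
  unfold meanD gibbsMean gibbsLaw partitionFn linAction
  simp only [Fin.sum_univ_two, Matrix.cons_val_zero, Matrix.cons_val_one, mul_zero, add_zero,
    neg_zero, Real.exp_zero, zero_add]
  have h : -(15 * Real.log 2 + c * -(40 * Real.log 2)) = (40 * c - 15) * Real.log 2 := by ring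
  rw [h]
  ring

end HalvingWitness

open HalvingWitness in
/-- **The witness.**  Two states, `S₀ = (0, 15 log 2)`, `D = (0, −40 log 2)`, uniform grids,
`ε = 1/2`: the COARSE protocol (2 switches, two sweeps each = laziness `(1/2)² = 1/4`) dissipates
STRICTLY LESS than the FINE one (4 switches, one sweep of laziness `1/2` each). -/
theorem lazyDissipation_halving_witness :
    lazyDissipation ![(0 : ℝ), 15 * Real.log 2] ![(0 : ℝ), -(40 * Real.log 2)]
        (fun k => (k : ℝ) / (2 : ℕ)) (((1 : ℝ) / 2) ^ 2) 2
      < lazyDissipation ![(0 : ℝ), 15 * Real.log 2] ![(0 : ℝ), -(40 * Real.log 2)]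
        (fun k => (k : ℝ) / (2 * (2 : ℕ))) ((1 : ℝ) / 2) (2 * 2) := by
  have hL : 0 < Real.log 2 := Real.log_pos one_lt_two
  have hF := meanWork_lazy_eq ![(0 : ℝ), 15 * Real.log 2] ![(0 : ℝ), -(40 * Real.log 2)]
    (fun k => (k : ℝ) / (2 * (2 : ℕ))) ((1 : ℝ) / 2) (2 * 2)
  have hC := meanWork_lazy_eq ![(0 : ℝ), 15 * Real.log 2] ![(0 : ℝ), -(40 * Real.log 2)]
    (fun k => (k : ℝ) / (2 : ℕ)) (((1 : ℝ) / 2) ^ 2) 2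
  beta_reduce at hF hC
  unfold lazyDissipation
  beta_reduce
  rw [hF, hC]
  have e5 : Real.exp (5 * Real.log 2) = 32 := by
    have := exp_nat_mul_log_two 5
    norm_num at this
    exact this
  have e15 : Real.exp (15 * Real.log 2) = 32768 := by
    have := exp_nat_mul_log_two 15
    norm_num at this
    exact this
  have em5 : Real.exp (-(5 * Real.log 2)) = 1 / 32 := by
    rw [Real.exp_neg, e5, one_div]
  have em15 : Real.exp (-(15 * Real.log 2)) = 1 / 32768 := by
    rw [Real.exp_neg, e15, one_div]
  simp only [sum_range_succ, sum_range_zero, lagSeq_succ, lagSeq_zero, meanD_eq]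
  norm_num [e5, e15, em5, em15]
  nlinarith [hL]

/-- **The equal-drop hypothesis of `lazyDissipation_halving_le` cannot be dropped**: it is not
true that for every finite system, step count and laziness the finer protocol at equal sweep budget
dissipates no more. -/
theorem not_lazyDissipation_halving_le :
    ¬ ∀ (S₀ D : Fin 2 → ℝ) (n : ℕ) (ε : ℝ), n ≠ 0 → 0 ≤ ε → ε ≤ 1 →
        lazyDissipation S₀ D (fun k => (k : ℝ) / (2 * n)) ε (2 * n)
          ≤ lazyDissipation S₀ D (fun k => (k : ℝ) / n) (ε ^ 2) n := by
  intro h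
  have h2 := h ![(0 : ℝ), 15 * Real.log 2] ![(0 : ℝ), -(40 * Real.log 2)] 2 (1 / 2)
    two_ne_zero (by norm_num) (by norm_num)
  exact absurd h2 (not_le.mpr lazyDissipation_halving_witness)

end Summit.Ventures.LatticeQCDFlow.Exactness
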